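import Summits.Ventures.CertifiedManyBodySolver.Theorems.TcThermcert1TrialGeneratorSockets
import HarnessLib

/-!
# Theorems landing (helper toward stmt-Ventures-26381, MILESTONE M-K1-R1(8), cell lead R149 (b) ∕ R150):
# the β·t = 8 RUNG SOCKET of crux K1 `ThermalStiffnessCeilingU8b10_le_1o8`, line «trialgen_b10», route «hubbard-tc-thermcert-1»

Theorems-side twin of the crux workfile `Cruxes/ThermalStiffnessCeilingU8b10_le_1o8/TrialGeneratorRungSocketB8.lean`
(hub-tc-therm-plan-1 g0, sha16 5462b152e7fcceaa, commit 60c032a05a6e; farm rc 0 ∕ 0 sorries; read-back CLEAN hub-tc-therm-crit-2 g1, tc STATUS l.2215),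
landed verbatim (namespace re-pointed to `…Theorems.TcThermcert1.RungB8`) by hubbard-tc-mod-3 g11 on the lead's SUMMONS (tc INBOX l.1856 ∕ l.1862).
A HELPER (`--supports stmt-Ventures-26381`), NOT a route item and NOT a stub: the typed SIBLING number target on the way to K1,

  `R1(8) := ObsThermalStiffnessSeqCeilingAtBeta 0 8 (7/8) 8 (7/44)`,

in the literal shape of K1 (`… 10 (1/8)`), so that the generic socket `leafAt_of_certificateAt` of
`Theorems/TcThermcert1TrialGeneratorSockets.lean` applies by `rfl`, together with its KT seam `(π/4)·(7/44) < 1/8` (⟺ `π < 22/7`)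
and the single-temperature KT point reading `T_KT(8, 7/8, 0) ≤ t/8` under the thermal KT dictionary
(`ThermalKTDictionaryAt.le_inv_of_leafAtBeta`; no monotonicity, no window).

HONEST FRAMING: one-sided CEILING chain under hypotheses; the certificate `TrialGeneratorCertificateAt 8 (7/44)` is the HYPOTHESIS of
every theorem here and is NOT proved (it is the producers' object — the same certificate shape as the registered stub
`stub_trialGeneratorCertificate_b10 : TrialGeneratorCertificateB10` at β·t = 10, asked at β·t = 8 with a longer tolerance: wall
`4/(8π) = 0.159155`, typed level `7/44 = 0.159091`, registered-family float `c_fam(β·t = 8) ≈ 0.139` [16-site, hubbard-thermal-eng-5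
K1-CLASS-REACH v0.5] ⇒ tolerance ≈ +0.020); R1(8) does NOT imply K1 (no monotonicity in β is claimed or used); rungs are helper lemmas,
not stubs and not items (BC6); no number of record moves; KT ceilings never assert superconductivity; NO lower bound on `T_c` is claimed;
no summit, crux or rung statement is proved in this file. ORDER (R149 (b)): the β·t = 6 lever test M-K1-R1 (`rung_b6`, `cert6`) comes first.

References: DLS1978 §2 eqs. (22′), (27), (28); HazraVermaRanderia2019 eqs. (2)–(4) (as in the sockets file).
-/

noncomputable section

namespace Summit.Ventures.CertifiedManyBodySolver.Theorems.TcThermcert1.RungB8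

open Real
open Summit.Ventures.CertifiedManyBodySolver.Observables
open Summit.Ventures.CertifiedManyBodySolver.Theorems.TcThermcert1

/-- **R1(8) socket (M-K1-R1(8))**: a trial-generator certificate per banded supporting `μ₀` at `β·t = 8`, level `7/44`, gives the
β·t = 8 leaf `ObsThermalStiffnessSeqCeilingAtBeta 0 8 (7/8) 8 (7/44)` — `leafAt_of_certificateAt` at `β = 8`.
[cite: HazraVermaRanderia2019, eqs. (2)–(4)] -/
theorem rung_b8 (h : TrialGeneratorCertificateAt 8 (7 / 44)) :
    ObsThermalStiffnessSeqCeilingAtBeta 0 8 (7 / 8) 8 (7 / 44) :=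
  leafAt_of_certificateAt (by norm_num) h

/-- **KT seam at β·t = 8**: `(π/4)·(7/44) < 1/8`, i.e. `π < 22/7`; Mathlib's `Real.pi_lt_d4 : π < 3.1416` suffices
(`3.1416 < 22/7 = 3.142857…`). -/
theorem seam_b8 : π / 4 * (((7 / 44 : ℚ) : ℚ) : ℝ) < 1 / (8 : ℝ) := by
  have hπ := Real.pi_lt_d4
  push_cast
  nlinarith

/-- **KT point reading from R1(8)**: under the thermal KT dictionary at `(U, n, t′) = (8, 7/8, 0)`, a certificate
`TrialGeneratorCertificateAt 8 (7/44)` gives `T_c ≤ 1/8` (tree units `t = 1`) — single temperature, no monotonicity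
(`ThermalKTDictionaryAt.le_inv_of_leafAtBeta`). A CEILING only. [cite: HazraVermaRanderia2019, eqs. (2)–(3)] -/
theorem kt_le_eighth_of_certificateAt_b8 {ρe : ℝ → ℝ} {Tc : ℝ} (hT : ThermalKTDictionaryAt 0 8 (7 / 8) ρe Tc)
    (h : TrialGeneratorCertificateAt 8 (7 / 44)) : Tc ≤ 1 / 8 :=
  hT.le_inv_of_leafAtBeta (by norm_num) (rung_b8 h) seam_b8

/-- The weaker clean rational `3/19` also passes the seam (`(π/4)(3/19) < 1/8` ⟺ `π < 19/6`, by `Real.pi_lt_d2`); recorded because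
it was the alternative on the table — `7/44` is the typed level (it gives away `6·10⁻⁵` against the wall, `3/19` gives away `0.0013`). -/
theorem seam_b8_alt : π / 4 * (((3 / 19 : ℚ) : ℚ) : ℝ) < 1 / (8 : ℝ) := by
  have hπ := Real.pi_lt_d2
  push_cast
  nlinarith

/-- Monotone book-keeping: any certificate level `q ≤ 7/44` at β·t = 8 feeds the same rung. -/
theorem rung_b8_of_le {q : ℚ} (hq : q ≤ 7 / 44) (h : TrialGeneratorCertificateAt 8 q) :
    ObsThermalStiffnessSeqCeilingAtBeta 0 8 (7 / 8) 8 (7 / 44) :=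
  (leafAt_of_certificateAt (by norm_num) h).mono hq

end Summit.Ventures.CertifiedManyBodySolver.Theorems.TcThermcert1.RungB8
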